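import Summits.BirchSwinnertonDyer.Rank2.LevelFifteenDescentParity
import Literature.NumberTheory.ModularForms.RademacherPhiCompositionProofs
import HarnessLib

/-!
# Manin symbols on `Γ₀(15)`, IX: the period homomorphism of the `(β₃, β₅) = (3, 1)`-stabilised weight-2 Eisenstein series
# of level `15`, its extension `eisE` to `SL(2, ℤ)` through the coset representatives, and its two MOVES along the Euclid descent

Cell `bsd-rank2` (D-0036), seat `bsd-rank2-eng` GEN 10; line `star` of the crux E1M `DepletedLambdaLawAtTwoMod`
(item stmt-BirchSwinnertonDyer-20341), engineering rung for the research stub (★-SymbC) at the one level where both sides are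
finite arithmetic. Objects:

* `eisPeriod15 a b c d = Ψ₃ + (1/5)Ψ₅ − (1/5)Ψ₁₅` (`Ψ_t(M) = Φ(M) − Φ(M_t)`, Rademacher's `Φ`, Literature
  `eisensteinPsi`): on `Γ₀(15)` this IS the period function `∑_{t ∣ 15} c_t Φ(M_t)` of the stabilised Eisenstein series
  with `c = (1, −1, −1/5, 1/5)` (because `∑ c_t = 0`), and it is a HOMOMORPHISM `Γ₀(15) → ℚ` (`eisPeriod15SL_mul`, from the
  composition law of `Φ`, Literature `eisensteinPsiSL_mul'`);
* `eisE k = eisPeriod15SL (k · rep_{cls(k)}⁻¹)` — its extension to `SL(2, ℤ)` through the coset representatives of part I;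
  it moves along the Euclid descent of part III by the TABLE values `eT4`, `eS4` (`15/4 ·` the periods of the 48 Schreier
  generators `rep_P T rep_{P·T}⁻¹`, `rep_P S rep_{P·S}⁻¹`, each a kernel evaluation of Dedekind sums: `eT_values`, `eS_values`);
* `eisE_mul_T`, `eisE_mul_S`: `eisE(kT) = eisE(k) + (4/15)eT4(cls k)`, `eisE(kS) = eisE(k) + (4/15)eS4(cls k)`.
Part X (`LevelFifteenEisensteinLaw`) proves from these the EISENSTEIN PERIOD LAW `(15/4)·eisE ≡ n₁ + lawTab (mod 4)` along the
exact descent, the input of the level-15 (★-SymbC) theorem.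

THEOREMS + two integer tables (`eT4`, `eS4`, data re-verified by `decide`); no `sorry`; standard axioms.
PARTITION: none — r_an ≥ 2, summit axis S0; TWIN (D-0056): n/a. B1 honesty: finite Dedekind-sum / Manin-symbol arithmetic at
level 15; nothing reads an analytic rank; no S0 motion; (★-SymbC) in general is NOT proved by this.

References: H. Rademacher, E. Grosswald, *Dedekind Sums*, Carus Monograph 16 (1972), Ch. 4 A eq. (59)–(62)
[RademacherGrosswald1972]; G. Stevens, *Arithmetic on Modular Curves*, Progr. Math. 20 (1982), §2.4–2.5 [Stevens1982];
Ju. I. Manin, *Izv. AN SSSR* 36 (1972) Thm. 1.6 [Manin1972]; J. E. Cremona, *Algorithms for modular elliptic curves* (1997)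
§2.2–§2.3 [CremonaAlgorithms1997].
-/

open scoped MatrixGroups ModularForm

open CongruenceSubgroup Matrix.SpecialLinearGroup ModularGroup
open Literature.NumberTheory.ModularForms

namespace Summit.BirchSwinnertonDyer.Rank2.LevelFifteen

/-! ### §1 The level-15 Eisenstein period and its additivity on `Γ₀(15)` -/

/-- **The period function of the `(3,1)`-stabilised Eisenstein series of level 15**, written through the level-raising
periods `Ψ_t` (`t = 3, 5, 15`): `φ = Ψ₃ + (1/5)Ψ₅ − (1/5)Ψ₁₅` (`= Φ − Φ₃ − (1/5)Φ₅ + (1/5)Φ₁₅` since `∑ c_t = 0`).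
[cite: Stevens1982, §2.4–2.5 (PDF pp. 35–38)] [cite: RademacherGrosswald1972, Ch. 4 A, eq. (59)–(60)] -/
def eisPeriod15 (a b c d : ℤ) : ℚ :=
  eisensteinPsi 3 a b c d + (1 / 5) * eisensteinPsi 5 a b c d - (1 / 5) * eisensteinPsi 15 a b c d

/-- `φ(M)` for `M ∈ SL(2, ℤ)`, entries read off the matrix. [cite: Stevens1982, §2.5 (PDF p. 38)] -/
def eisPeriod15SL (M : SL(2, ℤ)) : ℚ := eisPeriod15 (M 0 0) (M 0 1) (M 1 0) (M 1 1)

/-- Unfolding through the Literature `Ψ_t`. [cite: RademacherGrosswald1972, Ch. 4 A, eq. (59)–(60)] -/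
theorem eisPeriod15SL_eq (M : SL(2, ℤ)) :
    eisPeriod15SL M = eisensteinPsiSL 3 M + (1 / 5) * eisensteinPsiSL 5 M - (1 / 5) * eisensteinPsiSL 15 M := rfl

/-- **`φ` is additive on `Γ₀(15)`** (each `Ψ_t`, `t ∣ 15`, is additive on `Γ₀(t) ⊇ Γ₀(15)` by the composition law of `Φ`).
[cite: RademacherGrosswald1972, Ch. 4 A, eq. (62)] -/
theorem eisPeriod15SL_mul {A B : SL(2, ℤ)} (hA : (15 : ℤ) ∣ A 1 0) (hB : (15 : ℤ) ∣ B 1 0) :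
    eisPeriod15SL (A * B) = eisPeriod15SL A + eisPeriod15SL B := by
  have h3A : ((3 : ℕ) : ℤ) ∣ A 1 0 := (show ((3 : ℕ) : ℤ) ∣ 15 by norm_num).trans hA
  have h3B : ((3 : ℕ) : ℤ) ∣ B 1 0 := (show ((3 : ℕ) : ℤ) ∣ 15 by norm_num).trans hB
  have h5A : ((5 : ℕ) : ℤ) ∣ A 1 0 := (show ((5 : ℕ) : ℤ) ∣ 15 by norm_num).trans hA
  have h5B : ((5 : ℕ) : ℤ) ∣ B 1 0 := (show ((5 : ℕ) : ℤ) ∣ 15 by norm_num).trans hB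
  have h15A : ((15 : ℕ) : ℤ) ∣ A 1 0 := by exact_mod_cast hA
  have h15B : ((15 : ℕ) : ℤ) ∣ B 1 0 := by exact_mod_cast hB
  rw [eisPeriod15SL_eq, eisPeriod15SL_eq, eisPeriod15SL_eq, eisensteinPsiSL_mul' (by norm_num) h3A h3B,
    eisensteinPsiSL_mul' (by norm_num) h5A h5B, eisensteinPsiSL_mul' (by norm_num) h15A h15B]
  ring

/-- `φ` vanishes on the matrices with `c = 0` (`Φ(a b; 0 d) = b/d`, so `Ψ_t = (1 − t)·b/d` and the combination is `0`).
[cite: RademacherGrosswald1972, Ch. 4 A, eq. (59)] -/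
theorem eisPeriod15_c_zero (a b d : ℤ) : eisPeriod15 a b 0 d = 0 := by
  simp only [eisPeriod15, eisensteinPsi, Int.zero_ediv, rademacherPhi_of_c_eq_zero]
  push_cast
  ring

/-! ### §2 The coset part and the extension `eisE` of `φ` to `SL(2, ℤ)` -/

/-- Entries of a product in `SL(2, ℤ)`. [folklore] -/
theorem sl_mul_apply' (A B : SL(2, ℤ)) (i j : Fin 2) : (A * B) i j = A i 0 * B 0 j + A i 1 * B 1 j := by
  rw [Matrix.SpecialLinearGroup.coe_mul, Matrix.mul_apply, Fin.sum_univ_two]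

/-- Entries of an inverse in `SL(2, ℤ)`. [folklore] -/
theorem sl_inv_apply (A : SL(2, ℤ)) :
    (A⁻¹) 0 0 = A 1 1 ∧ (A⁻¹) 0 1 = -A 0 1 ∧ (A⁻¹) 1 0 = -A 1 0 ∧ (A⁻¹) 1 1 = A 0 0 := by
  refine ⟨?_, ?_, ?_, ?_⟩ <;>
    simp [Matrix.SpecialLinearGroup.coe_inv, Matrix.adjugate_fin_two]

/-- Entries of the representatives (top row). [cite: CremonaAlgorithms1997, §2.2] -/
@[simp] theorem rep_apply_00 (P : Fin 24) : (rep P) 0 0 = repA P := rfl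

/-- Entries of the representatives (top row). [cite: CremonaAlgorithms1997, §2.2] -/
@[simp] theorem rep_apply_01 (P : Fin 24) : (rep P) 0 1 = repB P := rfl

/-- **The `Γ₀(15)`-part `k · rep_{cls(k)}⁻¹` of `k` has lower-left entry divisible by `15`.** [cite: CremonaAlgorithms1997, §2.2 Prop. 2.2.2] -/
theorem fifteen_dvd_mul_inv_rep (k : SL(2, ℤ)) :
    (15 : ℤ) ∣ (k * (rep (clsInt (k 1 0) (k 1 1)))⁻¹) 1 0 := by
  rw [sl_mul_apply', (sl_inv_apply _).1, (sl_inv_apply _).2.2.1, rep_apply_10, rep_apply_11]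
  have h := tab_rep_int (k 1 0) (k 1 1) (adm_three k) (adm_five k)
  rw [clsInt]
  have e : k 1 0 * repD (clsTab ((k 1 0 : ℤ) : ZMod 15) ((k 1 1 : ℤ) : ZMod 15)) +
      k 1 1 * -repC (clsTab ((k 1 0 : ℤ) : ZMod 15) ((k 1 1 : ℤ) : ZMod 15)) =
      k 1 0 * repD (clsTab ((k 1 0 : ℤ) : ZMod 15) ((k 1 1 : ℤ) : ZMod 15)) -
      k 1 1 * repC (clsTab ((k 1 0 : ℤ) : ZMod 15) ((k 1 1 : ℤ) : ZMod 15)) := by ring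
  rw [e]; exact h

/-- **The extension of `φ` to `SL(2, ℤ)` through the coset representatives**: `eisE k = φ(k · rep_{cls(k)}⁻¹)`
(for `k ∈ Γ₀(15)` this is `φ(k)`). [cite: CremonaAlgorithms1997, §2.2] [cite: Stevens1982, §2.5 (PDF p. 38)] -/
noncomputable def eisE (k : SL(2, ℤ)) : ℚ := eisPeriod15SL (k * (rep (clsInt (k 1 0) (k 1 1)))⁻¹)

/-! ### §3 The Schreier generators and their periods (tables, kernel evaluation of Dedekind sums) -/

/-- `15/4 ·` the period of the `T`-Schreier generator `rep_P · T · rep_{P·T}⁻¹` of each class. [folklore] -/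
def eT4 : Fin 24 → ℤ := ![0, 0, 0, 0, 0, 0, 0, 0, 36, 0, 0, 0, 0, 0, 0, 0, -18, 18, -18, 0, -18, -18, 18, 0]

/-- `15/4 ·` the period of the `S`-Schreier generator `rep_P · S · rep_{P·S}⁻¹` of each class. [folklore] -/
def eS4 : Fin 24 → ℤ := ![0, 0, 0, -18, 0, 18, 0, 0, 18, -18, 0, 0, -18, 0, 18, 0, 0, 0, 0, -18, 0, 0, 0, 18]

/-- The `T`-Schreier generators lie in `Γ₀(15)` (table fact). [folklore] -/
theorem schreierT_mem : ∀ P : Fin 24,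
    (15 : ℤ) ∣ repC P * repD (tIdx P) - (repC P + repD P) * repC (tIdx P) := by
  decide

/-- The `S`-Schreier generators lie in `Γ₀(15)` (table fact). [folklore] -/
theorem schreierS_mem : ∀ P : Fin 24,
    (15 : ℤ) ∣ repD P * repD (sIdx P) + repC P * repC (sIdx P) := by
  decide

/-- **Periods of the `T`-Schreier generators** (`φ(rep_P T rep_{P·T}⁻¹) = (4/15)·eT4(P)`): a kernel evaluation of the
Dedekind sums of 24 explicit matrices. [cite: RademacherGrosswald1972, Ch. 4 A, eq. (59)] -/
theorem eT_values : ∀ P : Fin 24,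
    eisPeriod15 (repA P * repD (tIdx P) - (repA P + repB P) * repC (tIdx P))
      (-(repA P * repB (tIdx P)) + (repA P + repB P) * repA (tIdx P))
      (repC P * repD (tIdx P) - (repC P + repD P) * repC (tIdx P))
      (-(repC P * repB (tIdx P)) + (repC P + repD P) * repA (tIdx P)) = (eT4 P : ℚ) * 4 / 15 := by
  decide +kernel

/-- **Periods of the `S`-Schreier generators** (`φ(rep_P S rep_{P·S}⁻¹) = (4/15)·eS4(P)`). [cite: RademacherGrosswald1972, Ch. 4 A, eq. (59)] -/
theorem eS_values : ∀ P : Fin 24,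
    eisPeriod15 (repB P * repD (sIdx P) + repA P * repC (sIdx P))
      (-(repB P * repB (sIdx P)) - repA P * repA (sIdx P))
      (repD P * repD (sIdx P) + repC P * repC (sIdx P))
      (-(repD P * repB (sIdx P)) - repC P * repA (sIdx P)) = (eS4 P : ℚ) * 4 / 15 := by
  decide +kernel

/-! ### §4 The two moves of `eisE` -/

/-- **`T`-move**: `eisE(kT) = eisE(k) + (4/15)·eT4(cls k)`. [cite: Manin1972, Thm. 1.6] [cite: CremonaAlgorithms1997, §2.2] -/
theorem eisE_mul_T (k : SL(2, ℤ)) :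
    eisE (k * T) = eisE k + (eT4 (clsInt (k 1 0) (k 1 1)) : ℚ) * 4 / 15 := by
  set P := clsInt (k 1 0) (k 1 1) with hP
  have hcls : clsInt ((k * T) 1 0) ((k * T) 1 1) = tIdx P := by
    rw [mul_T_apply_10, mul_T_apply_11, hP, clsInt, clsInt]
    exact (tab_T_int (k 1 0) (k 1 1) (adm_three k) (adm_five k)).1
  unfold eisE
  rw [hcls, ← hP]
  have hfac : k * T * (rep (tIdx P))⁻¹ = (k * (rep P)⁻¹) * (rep P * T * (rep (tIdx P))⁻¹) := by group
  have hσ10 : (rep P * T * (rep (tIdx P))⁻¹) 1 0 = repC P * repD (tIdx P) - (repC P + repD P) * repC (tIdx P) := by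
    rw [sl_mul_apply', mul_T_apply_10, mul_T_apply_11, (sl_inv_apply _).1, (sl_inv_apply _).2.2.1, rep_apply_10,
      rep_apply_11, rep_apply_10, rep_apply_11]; ring
  have hmem : (15 : ℤ) ∣ (rep P * T * (rep (tIdx P))⁻¹) 1 0 := by rw [hσ10]; exact schreierT_mem P
  have hk : (15 : ℤ) ∣ (k * (rep P)⁻¹) 1 0 := by rw [hP]; exact fifteen_dvd_mul_inv_rep k
  rw [hfac, eisPeriod15SL_mul hk hmem]
  congr 1
  -- the value of the Schreier generator
  have h00 : (rep P * T * (rep (tIdx P))⁻¹) 0 0 = repA P * repD (tIdx P) - (repA P + repB P) * repC (tIdx P) := by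
    rw [sl_mul_apply', (sl_inv_apply _).1, (sl_inv_apply _).2.2.1, sl_mul_apply', sl_mul_apply']
    simp [coe_T]
    try ring
  have h01 : (rep P * T * (rep (tIdx P))⁻¹) 0 1 = -(repA P * repB (tIdx P)) + (repA P + repB P) * repA (tIdx P) := by
    rw [sl_mul_apply', (sl_inv_apply _).2.1, (sl_inv_apply _).2.2.2, sl_mul_apply', sl_mul_apply']
    simp [coe_T]
    try ring
  have h11 : (rep P * T * (rep (tIdx P))⁻¹) 1 1 = -(repC P * repB (tIdx P)) + (repC P + repD P) * repA (tIdx P) := by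
    rw [sl_mul_apply', mul_T_apply_10, mul_T_apply_11, (sl_inv_apply _).2.1, (sl_inv_apply _).2.2.2, rep_apply_10,
      rep_apply_11, rep_apply_00, rep_apply_01]; ring
  rw [eisPeriod15SL, h00, h01, hσ10, h11]
  exact eT_values P

/-- **`S`-move**: `eisE(kS) = eisE(k) + (4/15)·eS4(cls k)`. [cite: Manin1972, Thm. 1.6] [cite: CremonaAlgorithms1997, §2.2] -/
theorem eisE_mul_S (k : SL(2, ℤ)) :
    eisE (k * S) = eisE k + (eS4 (clsInt (k 1 0) (k 1 1)) : ℚ) * 4 / 15 := by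
  set P := clsInt (k 1 0) (k 1 1) with hP
  have hcls : clsInt ((k * S) 1 0) ((k * S) 1 1) = sIdx P := by
    rw [mul_S_apply_10, mul_S_apply_11, hP, clsInt, clsInt]
    exact (tab_S_int (k 1 0) (k 1 1) (adm_three k) (adm_five k)).1
  unfold eisE
  rw [hcls, ← hP]
  have hfac : k * S * (rep (sIdx P))⁻¹ = (k * (rep P)⁻¹) * (rep P * S * (rep (sIdx P))⁻¹) := by group
  have hσ10 : (rep P * S * (rep (sIdx P))⁻¹) 1 0 = repD P * repD (sIdx P) + repC P * repC (sIdx P) := by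
    rw [sl_mul_apply', mul_S_apply_10, mul_S_apply_11, (sl_inv_apply _).1, (sl_inv_apply _).2.2.1, rep_apply_10,
      rep_apply_11, rep_apply_10, rep_apply_11]; ring
  have hmem : (15 : ℤ) ∣ (rep P * S * (rep (sIdx P))⁻¹) 1 0 := by rw [hσ10]; exact schreierS_mem P
  have hk : (15 : ℤ) ∣ (k * (rep P)⁻¹) 1 0 := by rw [hP]; exact fifteen_dvd_mul_inv_rep k
  rw [hfac, eisPeriod15SL_mul hk hmem]
  congr 1
  have h00 : (rep P * S * (rep (sIdx P))⁻¹) 0 0 = repB P * repD (sIdx P) + repA P * repC (sIdx P) := by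
    rw [sl_mul_apply', (sl_inv_apply _).1, (sl_inv_apply _).2.2.1, sl_mul_apply', sl_mul_apply']
    simp [coe_S]
    try ring
  have h01 : (rep P * S * (rep (sIdx P))⁻¹) 0 1 = -(repB P * repB (sIdx P)) - repA P * repA (sIdx P) := by
    rw [sl_mul_apply', (sl_inv_apply _).2.1, (sl_inv_apply _).2.2.2, sl_mul_apply', sl_mul_apply']
    simp [coe_S]
    try ring
  have h11 : (rep P * S * (rep (sIdx P))⁻¹) 1 1 = -(repD P * repB (sIdx P)) - repC P * repA (sIdx P) := by
    rw [sl_mul_apply', mul_S_apply_10, mul_S_apply_11, (sl_inv_apply _).2.1, (sl_inv_apply _).2.2.2, rep_apply_10,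
      rep_apply_11, rep_apply_00, rep_apply_01]; ring
  rw [eisPeriod15SL, h00, h01, hσ10, h11]
  exact eS_values P

end Summit.BirchSwinnertonDyer.Rank2.LevelFifteen
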